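import Mathlib
import Summits.NavierStokesRegularity.NavierStokesRegularity.Theorems.FilamentSkeletonRssDefectColumnGateAzimuthalBlockResolventBound
import Summits.NavierStokesRegularity.NavierStokesRegularity.Theorems.FilamentSkeletonRssDefectColumnGateAzimuthalBlockCoreGauss

/-!
# Route `FilamentSkeletonRss` · crux `TransverseReduction1AG` (stmt-NavierStokesRegularity-27853; A1L twin stmt-23297) · line
# `defect_column_gate_1AG/1AL` — the m-block resolvent bound for EVERY support radius `U > 0`

Helper file (`--supports stmt-NavierStokesRegularity-27853 --as helper`; seat ns-filament-s2aloc-p1 g2; note ARCHITECTURE-B2B3-s2aloc-g2.md v6 §8b).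
`twoZone_resolvent_bound` (p685865) covers support radii `U ≥ (12/γ)log Rc + 3/γ` (two-zone regime); below that the whole support sits in the
Gaussian core and `coreGauss_sup_sq_le` (p675134) applies directly (`e^{γU/4} ≤ e^{3/4}Rc³`).  `twoZone_resolvent_bound_allU` is the two-case
wrapper: for `0 < γ`, `2 ≤ m` there are `R₀ ≥ 1`, `C ≥ 0` (γ, m only) such that for `Rc ≥ R₀`, `40π|ρ|((12/γ)log Rc + 7/γ) ≤ Rc`, EVERY `U > 0` and
every Biot–Savart-coupled azimuthal block of the symmetric column (LEAD-style hypotheses, support `[0,U]`, data `(1+u)²|f_i| ≤ M`):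
`∀ u ∈ [0,U], (1+u)⁴(a² + b²) ≤ C·(1 + log Rc)¹¹·Rc³·M²`.
HONEST FRAMING: an a-priori (resolvent) bound for ONE family of blocks (`m ≥ 2`, symmetric column) of ONE linear MODEL operator of a hypothetical
blow-up route (MODEL rung, negative side); `WaistColumnGateLoc1A`, `TransverseReduction1AG/1AL` are neither proved nor refuted; nothing here
bears on NS regularity.
-/

set_option linter.dupNamespace false

noncomputable section

namespace Summit.NavierStokesRegularity.NavierStokesRegularity.Theorems.DefectColumnGate

open Set MeasureTheory intervalIntegral

/-- **m-block resolvent bound with polynomial loss, every support radius** (symmetric column, Biot–Savart-coupled azimuthal blocks `m ≥ 2`). -/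
theorem twoZone_resolvent_bound_allU {γ m : ℝ} (hγ : 0 < γ) (hm : 2 ≤ m) :
    ∃ R₀ C : ℝ, 1 ≤ R₀ ∧ 0 ≤ C ∧ ∀ (Rc ρ U M : ℝ) (a a₁ b b₁ φa φa₁ φb φb₁ f₁ f₂ : ℝ → ℝ),
      R₀ ≤ Rc →
      0 < U →
      40 * Real.pi * |ρ| * (12 / γ * Real.log Rc + 7 / γ) ≤ Rc →
      ContinuousOn a (Ici 0) →
      ContinuousOn b (Ici 0) →
      ContinuousOn a₁ (Ioi 0) →
      ContinuousOn b₁ (Ioi 0) →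
      ContinuousOn φa (Ici 0) →
      ContinuousOn φb (Ici 0) →
      ContinuousOn f₁ (Ici 0) →
      ContinuousOn f₂ (Ici 0) →
      ContinuousOn (fun s => 4 * s * a₁ s + γ * s * a s) (Ici 0) →
      ContinuousOn (fun s => 4 * s * b₁ s + γ * s * b s) (Ici 0) →
      ContinuousOn (fun s => s * φa₁ s) (Ici 0) →
      ContinuousOn (fun s => s * φb₁ s) (Ici 0) →
      a 0 = 0 →
      b 0 = 0 →
      φa 0 = 0 →
      φb 0 = 0 →
      (∀ u, 0 < u → HasDerivAt a (a₁ u) u) →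
      (∀ u, 0 < u → HasDerivAt b (b₁ u) u) →
      (∀ u, 0 < u → HasDerivAt φa (φa₁ u) u) →
      (∀ u, 0 < u → HasDerivAt φb (φb₁ u) u) →
      (∀ u, 0 < u → HasDerivAt (fun s => 4 * s * a₁ s + γ * s * a s)
        (m ^ 2 / u * a u - m * (ρ + Rc * ((1 - Real.exp (-(γ * u / 4))) / (2 * Real.pi * u))) * b u
          + γ * m * Rc / 2 * (γ / (4 * Real.pi) * Real.exp (-(γ * u / 4))) * φb u - f₁ u) u) →
      (∀ u, 0 < u → HasDerivAt (fun s => 4 * s * b₁ s + γ * s * b s)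
        (m ^ 2 / u * b u + m * (ρ + Rc * ((1 - Real.exp (-(γ * u / 4))) / (2 * Real.pi * u))) * a u
          - γ * m * Rc / 2 * (γ / (4 * Real.pi) * Real.exp (-(γ * u / 4))) * φa u - f₂ u) u) →
      (∀ u, 0 < u → HasDerivAt (fun s => s * φa₁ s) ((m ^ 2 / u * φa u - a u) / 4) u) →
      (∀ u, 0 < u → HasDerivAt (fun s => s * φb₁ s) ((m ^ 2 / u * φb u - b u) / 4) u) →
      (∀ u, U ≤ u → a u = 0) →
      (∀ u, U ≤ u → b u = 0) →
      (∀ u, U ≤ u → φa u = 0) →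
      (∀ u, U ≤ u → φb u = 0) →
      (∀ u, 0 ≤ u → (1 + u) ^ 2 * |f₁ u| ≤ M) →
      (∀ u, 0 ≤ u → (1 + u) ^ 2 * |f₂ u| ≤ M) →
      IntervalIntegrable (fun u => Real.exp (γ * u / 4)
        * ((1 - Real.exp (-(γ * u / 4))) / (2 * Real.pi * u)) * (a u ^ 2 + b u ^ 2)) volume 0 U →
      IntervalIntegrable (fun u => Real.exp (γ * u / 4) * (a u ^ 2 + b u ^ 2)) volume 0 U →
      IntervalIntegrable (fun u => Real.exp (γ * u / 4) * (a u * f₂ u - b u * f₁ u)) volume 0 U →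
      IntervalIntegrable (fun u => Real.exp (γ * u / 4) * (a u * f₁ u + b u * f₂ u)) volume 0 U →
      IntervalIntegrable (fun u => Real.exp (γ * u / 4) * (4 * u * (a₁ u ^ 2 + b₁ u ^ 2))) volume 0 U →
      IntervalIntegrable (fun u => Real.exp (γ * u / 4) * (m ^ 2 / u * (a u ^ 2 + b u ^ 2))) volume 0 U →
      IntervalIntegrable (fun u => a u * φa u) volume 0 U →
      IntervalIntegrable (fun u => b u * φb u) volume 0 U →
      IntervalIntegrable (fun u => 4 * u * φa₁ u ^ 2) volume 0 U →
      IntervalIntegrable (fun u => m ^ 2 / u * φa u ^ 2) volume 0 U →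
      IntervalIntegrable (fun u => 4 * u * φb₁ u ^ 2) volume 0 U →
      IntervalIntegrable (fun u => m ^ 2 / u * φb u ^ 2) volume 0 U →
      IntervalIntegrable (fun u => u * a u ^ 2) volume 0 U →
      IntervalIntegrable (fun u => u * b u ^ 2) volume 0 U →
      IntervalIntegrable (fun u => b u * φa u - a u * φb u) volume 0 U →
      ∀ u ∈ Icc 0 U, (1 + u) ^ 4 * (a u ^ 2 + b u ^ 2) ≤ C * (1 + Real.log Rc) ^ 11 * Rc ^ 3 * M ^ 2 := by
  have hπ : 0 < Real.pi := Real.pi_pos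
  have hm0 : 0 < m := by linarith
  obtain ⟨R₀, C, hR₀1, hC0, hmain⟩ := twoZone_resolvent_bound hγ hm
  -- the constant of the small-support case
  obtain ⟨Cs, hCs⟩ : ∃ x : ℝ, x = (1 + 15 / γ) ^ 4 * (45 / γ)
      * (100 * (38 * Real.pi / γ) * ((γ + 1) * (38 * Real.pi / γ) + 4) / m ^ 2 + 1) := ⟨_, rfl⟩
  have hCs0 : 0 ≤ Cs := by rw [hCs]; positivity
  refine ⟨R₀, C + Cs, hR₀1, by positivity, ?_⟩
  intro Rc ρ U M a a₁ b b₁ φa φa₁ φb φb₁ f₁ f₂ hRc hU hρ ha hb ha₁' hb₁' hφa hφb hf₁c hf₂c hΦac hΦbc hPac hPbc ha0 hb0 hφa0 hφb0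
    hdera hderb hderφa hderφb hΦa hΦb hPa hPb hsuppa hsuppb hsuppφa hsuppφb hf₁ hf₂
    hIΩ hIE hIf hIg hID₁ hID₂ hIaφ hIbφ hIBa₁ hIBa₂ hIBb₁ hIBb₂ hIua hIub hIcross u hu
  have hRc1 : 1 ≤ Rc := le_trans hR₀1 hRc
  have hRc0 : 0 < Rc := by linarith only [hRc1]
  have hL0 : 0 ≤ Real.log Rc := Real.log_nonneg hRc1
  have hℓ : 0 < 1 / γ := by positivity
  have hM0 : 0 ≤ M := le_trans (by positivity) (hf₁ 0 le_rfl)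
  have hs0 : 0 ≤ a u ^ 2 + b u ^ 2 := by positivity
  have hQ1 : 1 ≤ 1 + Real.log Rc := by linarith only [hL0]
  rcases le_or_gt (12 / γ * Real.log Rc + 3 / γ) U with hbig | hsmall
  · -- two-zone regime
    have hρ6 : 40 * Real.pi * |ρ| * (12 / γ * Real.log Rc + 6 / γ) ≤ Rc := by
      have h1 : 12 / γ * Real.log Rc + 6 / γ ≤ 12 / γ * Real.log Rc + 7 / γ := by
        have : 6 / γ ≤ 7 / γ := div_le_div_of_nonneg_right (by norm_num) hγ.le
        linarith only [this]
      exact (mul_le_mul_of_nonneg_left h1 (by positivity)).trans hρ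
    have h := hmain Rc ρ U M a a₁ b b₁ φa φa₁ φb φb₁ f₁ f₂ hRc hbig hρ6 ha hb ha₁' hb₁' hφa hφb hf₁c hf₂c hΦac hΦbc hPac hPbc
      ha0 hb0 hφa0 hφb0 hdera hderb hderφa hderφb hΦa hΦb hPa hPb hsuppa hsuppb hsuppφa hsuppφb hf₁ hf₂
      hIΩ hIE hIf hIg hID₁ hID₂ hIaφ hIbφ hIBa₁ hIBa₂ hIBb₁ hIBb₂ hIua hIub hIcross u hu
    have h2 : 0 ≤ Cs * (1 + Real.log Rc) ^ 11 * Rc ^ 3 * M ^ 2 := by positivity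
    have e : (C + Cs) * (1 + Real.log Rc) ^ 11 * Rc ^ 3 * M ^ 2
        = C * (1 + Real.log Rc) ^ 11 * Rc ^ 3 * M ^ 2 + Cs * (1 + Real.log Rc) ^ 11 * Rc ^ 3 * M ^ 2 := by ring
    rw [e]; linarith only [h, h2]
  · -- pure Gaussian-core regime: the whole support sits in the core
    have hρU : 40 * Real.pi * |ρ| * (U + 4 / γ) ≤ Rc := by
      have h1 : U + 4 / γ ≤ 12 / γ * Real.log Rc + 7 / γ := by
        have e : 7 / γ = 3 / γ + 4 / γ := by ring
        rw [e]; linarith only [hsmall]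
      exact (mul_le_mul_of_nonneg_left h1 (by positivity)).trans hρ
    have hcore := coreGauss_sup_sq_le hγ hm hRc1 hU hρU
      (ha.mono (fun v hv => hv.1)) (hb.mono (fun v hv => hv.1)) (ha₁'.mono (fun v hv => hv.1)) (hb₁'.mono (fun v hv => hv.1))
      (hφa.mono (fun v hv => hv.1)) (hφb.mono (fun v hv => hv.1)) (hΦac.mono (fun v hv => hv.1)) (hΦbc.mono (fun v hv => hv.1))
      (hPac.mono (fun v hv => hv.1)) (hPbc.mono (fun v hv => hv.1)) ha0 hb0 hφa0 hφb0
      (fun v hv => hdera v hv.1) (fun v hv => hderb v hv.1) (fun v hv => hderφa v hv.1) (fun v hv => hderφb v hv.1)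
      (fun v hv => hΦa v hv.1) (fun v hv => hΦb v hv.1) (fun v hv => hPa v hv.1) (fun v hv => hPb v hv.1)
      (hsuppa U le_rfl) (hsuppb U le_rfl) (hsuppφa U le_rfl) (hsuppφb U le_rfl)
      (fun v hv => hf₁ v hv.1) (fun v hv => hf₂ v hv.1)
      hIΩ hIE hIf hIg hID₁ hID₂ hIaφ hIbφ hIBa₁ hIBa₂ hIBb₁ hIBb₂ hIua hIub hIcross u hu
    -- sizes: `Q := 1 + log Rc ≥ 1`, `U ≤ (15/γ)Q`, `1 + U ≤ (1 + 15/γ)Q`, `e^{γU/4} ≤ 3Rc³`, `K ≤ (38π/γ)Q`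
    generalize hQdef : 1 + Real.log Rc = Q at hQ1 ⊢
    have hLQ : Real.log Rc = Q - 1 := by linarith only [hQdef]
    have hUQ : U ≤ 15 / γ * Q := by
      have e : 12 / γ * Real.log Rc + 3 / γ = 12 / γ * Q - 9 / γ := by rw [hLQ]; ring
      have h9 : 0 < 9 / γ := by positivity
      have e2 : 15 / γ * Q = 12 / γ * Q + 3 * (1 / γ) * Q := by ring
      nlinarith only [hsmall, e, h9, e2, hQ1, hℓ]
    have h1U : 1 + U ≤ (1 + 15 / γ) * Q := by nlinarith only [hUQ, hQ1]
    have hexpU : Real.exp (γ * U / 4) ≤ 3 * Rc ^ 3 := by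
      have h1 : γ * U / 4 ≤ 3 * Real.log Rc + 3 / 4 := by
        have h2 : γ * U ≤ γ * (12 / γ * Real.log Rc + 3 / γ) := mul_le_mul_of_nonneg_left hsmall.le hγ.le
        have e : γ * (12 / γ * Real.log Rc + 3 / γ) = 12 * Real.log Rc + 3 := by field_simp
        linarith only [h2, e]
      have h3 := Real.exp_le_exp.mpr h1
      have e2 : Real.exp (3 * Real.log Rc + 3 / 4) = Rc ^ 3 * Real.exp (3 / 4) := by
        rw [Real.exp_add, show 3 * Real.log Rc = Real.log Rc + Real.log Rc + Real.log Rc by ring, Real.exp_add, Real.exp_add,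
          Real.exp_log hRc0]; ring
      have he3 : Real.exp (3 / 4) ≤ 3 := by
        have h4 : Real.exp (3 / 4) ≤ Real.exp 1 := Real.exp_le_exp.mpr (by norm_num)
        have := Real.exp_one_lt_d9; norm_num at this; linarith
      rw [e2] at h3
      have h5 : Rc ^ 3 * Real.exp (3 / 4) ≤ Rc ^ 3 * 3 := mul_le_mul_of_nonneg_left he3 (by positivity)
      linarith only [h3, h5]
    have hKQ : 2 * Real.pi * (U + 4 / γ) ≤ 38 * Real.pi / γ * Q := by
      have h1 : U + 4 / γ ≤ 19 / γ * Q := by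
        have : 4 / γ ≤ 4 / γ * Q := by nlinarith only [hQ1, hℓ, show 4 / γ = 4 * (1 / γ) by ring]
        have e : 19 / γ * Q = 15 / γ * Q + 4 / γ * Q := by ring
        linarith only [hUQ, this, e]
      have := mul_le_mul_of_nonneg_left h1 (show 0 ≤ 2 * Real.pi by positivity)
      have e : 2 * Real.pi * (19 / γ * Q) = 38 * Real.pi / γ * Q := by ring
      linarith only [this, e]
    have hK0 : 0 ≤ 2 * Real.pi * (U + 4 / γ) := by positivity
    have hfac : 100 * (2 * Real.pi * (U + 4 / γ)) * ((γ + 1) * (2 * Real.pi * (U + 4 / γ)) + 4) / m ^ 2 + 1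
        ≤ (100 * (38 * Real.pi / γ) * ((γ + 1) * (38 * Real.pi / γ) + 4) / m ^ 2 + 1) * Q ^ 2 := by
      have h1 : 100 * (2 * Real.pi * (U + 4 / γ)) * ((γ + 1) * (2 * Real.pi * (U + 4 / γ)) + 4)
          ≤ 100 * (38 * Real.pi / γ * Q) * ((γ + 1) * (38 * Real.pi / γ * Q) + 4 * Q) :=
        mul_le_mul (by linarith only [hKQ]) (by nlinarith only [hKQ, hQ1, hγ]) (by positivity) (by positivity)
      have h2 := div_le_div_of_nonneg_right h1 (sq_nonneg m)
      have h3 : (1:ℝ) ≤ Q ^ 2 := one_le_pow₀ hQ1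
      have e : (100 * (38 * Real.pi / γ) * ((γ + 1) * (38 * Real.pi / γ) + 4) / m ^ 2 + 1) * Q ^ 2
          = 100 * (38 * Real.pi / γ * Q) * ((γ + 1) * (38 * Real.pi / γ * Q) + 4 * Q) / m ^ 2 + Q ^ 2 := by
        field_simp
      rw [e]; linarith only [h2, h3]
    have hfac0 : 0 ≤ 100 * (2 * Real.pi * (U + 4 / γ)) * ((γ + 1) * (2 * Real.pi * (U + 4 / γ)) + 4) / m ^ 2 + 1 := by positivity
    have hpre : U * Real.exp (γ * U / 4) / Rc ≤ 45 / γ * Q * Rc ^ 2 := by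
      rw [div_le_iff₀ hRc0]
      have h1 : U * Real.exp (γ * U / 4) ≤ (15 / γ * Q) * (3 * Rc ^ 3) := mul_le_mul hUQ hexpU (by positivity) (by positivity)
      have e : (15 / γ * Q) * (3 * Rc ^ 3) = 45 / γ * Q * Rc ^ 2 * Rc := by ring
      linarith only [h1, e]
    have hpre0 : 0 ≤ U * Real.exp (γ * U / 4) / Rc := by positivity
    -- assemble
    have h14 : (1 + u) ^ 4 ≤ ((1 + 15 / γ) * Q) ^ 4 := pow_le_pow_left₀ (by linarith only [hu.1]) (by linarith only [hu.2, h1U]) 4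
    have hprod : (1 + u) ^ 4 * (a u ^ 2 + b u ^ 2)
        ≤ ((1 + 15 / γ) * Q) ^ 4 * ((45 / γ * Q * Rc ^ 2) * ((100 * (38 * Real.pi / γ) * ((γ + 1) * (38 * Real.pi / γ) + 4) / m ^ 2 + 1) * Q ^ 2)
            * M ^ 2) := by
      have h1 : a u ^ 2 + b u ^ 2 ≤ (45 / γ * Q * Rc ^ 2) * ((100 * (38 * Real.pi / γ) * ((γ + 1) * (38 * Real.pi / γ) + 4) / m ^ 2 + 1) * Q ^ 2)
          * M ^ 2 := hcore.trans (mul_le_mul_of_nonneg_right (mul_le_mul hpre hfac hfac0 (by positivity)) (sq_nonneg M))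
      exact mul_le_mul h14 h1 hs0 (by positivity)
    have e : ((1 + 15 / γ) * Q) ^ 4 * ((45 / γ * Q * Rc ^ 2) * ((100 * (38 * Real.pi / γ) * ((γ + 1) * (38 * Real.pi / γ) + 4) / m ^ 2 + 1) * Q ^ 2)
            * M ^ 2) = Cs * Q ^ 7 * Rc ^ 2 * M ^ 2 := by rw [hCs]; ring
    rw [e] at hprod
    have hup : Cs * Q ^ 7 * Rc ^ 2 * M ^ 2 ≤ Cs * Q ^ 11 * Rc ^ 3 * M ^ 2 := by
      have h1 : Q ^ 7 ≤ Q ^ 11 := pow_le_pow_right₀ hQ1 (by norm_num)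
      have h2 : Rc ^ 2 ≤ Rc ^ 3 := pow_le_pow_right₀ hRc1 (by norm_num)
      have h3 : Q ^ 7 * Rc ^ 2 ≤ Q ^ 11 * Rc ^ 3 := mul_le_mul h1 h2 (by positivity) (by positivity)
      have := mul_le_mul_of_nonneg_right (mul_le_mul_of_nonneg_left h3 hCs0) (sq_nonneg M)
      linarith only [this]
    have h2 : 0 ≤ C * Q ^ 11 * Rc ^ 3 * M ^ 2 := by positivity
    have e2 : (C + Cs) * Q ^ 11 * Rc ^ 3 * M ^ 2 = C * Q ^ 11 * Rc ^ 3 * M ^ 2 + Cs * Q ^ 11 * Rc ^ 3 * M ^ 2 := by ring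
    rw [e2]; linarith only [hprod, hup, h2]

end Summit.NavierStokesRegularity.NavierStokesRegularity.Theorems.DefectColumnGate

end
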